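import Summits.ValiantsHypothesis.ValiantsHypothesis.Theses.ValuativeGCT
import Summits.ValiantsHypothesis.ValiantsHypothesis.Theorems.ValuativeGCTValuativeFlipTailSuffices
import Summits.ValiantsHypothesis.ValiantsHypothesis.Theorems.ValuativeGCTValuativeFlipPerAnchorInheritanceEvery
import Summits.ValiantsHypothesis.ValiantsHypothesis.Theorems.ValuativeGCTValuativeFlipRayStabilityKronecker
import Summits.ValiantsHypothesis.ValiantsHypothesis.Theorems.ValuativeGCTValuativeFlipKroneckerCensus
import Summits.ValiantsHypothesis.ValiantsHypothesis.Theorems.ValuativeGCTValuativeFlipIdealBodyBound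
import Summits.ValiantsHypothesis.ValiantsHypothesis.Theorems.ValuativeGCTValuativeFlipInnerRichness
import Summits.ValiantsHypothesis.ValiantsHypothesis.Theorems.ValuativeGCTValuativeFlipDiagonalInheritance
import Summits.ValiantsHypothesis.ValiantsHypothesis.Theorems.ValuativeGCTValuativeFlipRayFromBottom
import Summits.ValiantsHypothesis.ValiantsHypothesis.Theorems.ValuativeGCTValuativeFlipNoSmallBodyEquations
import Summits.ValiantsHypothesis.ValiantsHypothesis.Theorems.ValuativeGCTValuativeFlipPerSideRowCap

/-!
# Strategist gen-1 sketch (crux stmt-ValiantsHypothesis-12624 `ValuativeGCT.ValuativeFlip` ≡ `TailFlip`)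

Typed forms of the statements discussed in `STRATEGY-CENSUS.md` (gen 1, tail re-census).  Nothing here is
registered; the file only certifies that the census's signatures elaborate over existing declarations and
records `#check`s of the landed theorems it leans on.
-/

set_option linter.dupNamespace false

namespace Summit.ValiantsHypothesis.ValiantsHypothesis.Cruxes.ValuativeFlip.StrategistGen1

open Literature.NumberTheory.DiophantineGeometry Literature.Computability.AlgebraicComplexity
open Literature.Computability.Complexity
open Summit.ValiantsHypothesis.ValiantsHypothesis.Theses.ValuativeGCT
open Summit.ValiantsHypothesis.ValiantsHypothesis.Theorems.ValuativeFlip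

/-! ## Landed theorems the census leans on (names must resolve) -/
#check @tailFlip_iff_valuativeFlip
#check @valuativeFlip_iff_polyPadded
#check @valuativeFlip_iff_longShapes
#check @perAnchorInheritance_every
#check @kronecker_ray_mono
#check @kronecker_ray_const_from_body
#check @stub_truncT0_le_kronecker
#check @plethysmCoeff_lt_of_flip
#check @plethysmCoeff_le_orbitMultiplicity_det_add_card
#check @valuativeFlip_of_innerRichness
#check @orbitMultiplicity_paddedPer_le_diag
#check @orbitMultiplicity_rowLift_add_finrank_twistKer
#check @noSmallBodyFlip
#check @perSide_rowCap

/-- The window top `M_c(n) = 2^((log₂ n + c)^c)`. -/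
def windowTop (n c : ℕ) : ℕ := 2 ^ ((Nat.log 2 n + c) ^ c)

/-- **S-A / R1 (`TopRowLiftKroneckerFlip`, the free window-top collapse of TRIAGE-r2-2, here with the
guard `c ≥ 2`)**: for every window exponent `c ≥ 2`, eventually in `n`, SOME inner shape `μ ⊢ nδ`
(at most `n²` parts) has the rectangular Kronecker coefficient of its row lift to the window TOP strictly
below the UNPADDED inner multiplicity `P_n(μ) = mult_{μ*} ℂ[Δ_n(per_n)]`.  Strictly stronger than the crux
(it implies `ValuativeFlip` by `stub_truncT0_le_kronecker` + `kronecker_ray_mono` +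
`perAnchorInheritance_every` + `valuativeFlip_iff_polyPadded`; W.lean of TRIAGE-r2-2 on stmt-15687). -/
def TopRowLiftKroneckerFlip : Prop :=
  ∀ c : ℕ, 2 ≤ c → ∃ n₀ : ℕ, ∀ (n : ℕ) [NeZero n], n₀ ≤ n →
    ∃ (δ : ℕ) (μ : Nat.Partition (n * δ)), μ.parts.card ≤ n * n ∧
      kroneckerCoeff ℂ (rowLift μ (windowTop n c - n))
          (Nat.Partition.rectangle (n + (windowTop n c - n)) δ)
          (Nat.Partition.rectangle (n + (windowTop n c - n)) δ) <
        orbitMultiplicity ℂ (paddedPerFormLex ℂ n n) n (partitionWeightLex n μ)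

/-- **Necessary shape of an R1 witness** (census §Transfer T-B): the body `nδ − μ₁` must exceed the
window top (else the Kronecker ray is already constant there, `kronecker_ray_const_from_body`, and
its value dominates `P_n(μ)`), so `δ > M_c(n)/n`. Typed as the property R1 witnesses must have. -/
def R1WitnessShape (n c δ : ℕ) (μ : Nat.Partition (n * δ)) : Prop :=
  windowTop n c < bodySize μ ∧ windowTop n c < n * δ

/-- **N-C target 1 (`NoSkFlipPoly`, the `U = ⊥` shadow of `NoValuativeFlip`, stmt-12629)**: from some
polynomial padding on, NO symmetric-Kronecker (no-cut) flip exists: for `m ≥ n^{c₀}` and every `(δ, λ)`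
the padded-permanent multiplicity is at most the dimension of the space of `Stab(det_m)`-invariant
highest-weight vectors of weight `λ*` (the crux's `T` with the valuative factor dropped).  The census's
heuristic predicts this with `c₀ ≈ 8`; it REFUTES `GCTMult.GctKroneckerFlip` (stmt-0888) inside every
window `c ≥ 2` and reduces `ValuativeFlip` to exponentially strong Edmonds-gap cuts. -/
def NoSkFlipPoly : Prop :=
  ∃ c₀ n₀ : ℕ, ∀ (n m : ℕ) [NeZero m], n₀ ≤ n → n ^ c₀ ≤ m → ∀ (δ : ℕ) (lam : Nat.Partition (m * δ)),
    lam.parts.card ≤ m * m →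
    orbitMultiplicity ℂ (paddedPerFormLex ℂ n m) m ((Weight.dualOfPartition (m * m) lam).toMatIdx) ≤
      Module.finrank ℂ ↥(MvPolynomial.homogeneousSubmodule (MatIdx m × MatIdx m) ℂ (m * δ) ⊓
        (⨅ (M : Matrix (MatIdx m) (MatIdx m) ℂ)
          (_ : linSubst (MatIdx m) ℂ M (detFormLex ℂ m) = detFormLex ℂ m),
          LinearMap.ker ((MvPolynomial.aeval fun p : MatIdx m × MatIdx m =>
              ∑ l : MatIdx m, M l p.2 •
                (MvPolynomial.X (p.1, l) : MvPolynomial (MatIdx m × MatIdx m) ℂ)).toLinearMap -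
            (LinearMap.id : MvPolynomial (MatIdx m × MatIdx m) ℂ →ₗ[ℂ] MvPolynomial (MatIdx m × MatIdx m) ℂ))) ⊓
        (⨅ (g : Matrix.GeneralLinearGroup (MatIdx m) ℂ) (_ : IsUpperTriangular g),
          LinearMap.ker ((MvPolynomial.aeval fun p : MatIdx m × MatIdx m =>
              ∑ l : MatIdx m, ((g⁻¹ : Matrix.GeneralLinearGroup (MatIdx m) ℂ) :
                Matrix (MatIdx m) (MatIdx m) ℂ) p.1 l •
                  (MvPolynomial.X (l, p.2) : MvPolynomial (MatIdx m × MatIdx m) ℂ)).toLinearMap -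
            weightChar ((Weight.dualOfPartition (m * m) lam).toMatIdx : Weight (MatIdx m)) g •
              (LinearMap.id : MvPolynomial (MatIdx m × MatIdx m) ℂ →ₗ[ℂ] MvPolynomial (MatIdx m × MatIdx m) ℂ))))

/-- **N-C target 2 (`PerCeilingPoly`, provable now; census §Negation N-A(iii))**: the padded-permanent
multiplicity is bounded by a polynomial in the BODY SIZE `b = mδ − λ₁` whose degree depends on `n` only
(`≈ n⁴ + n²`: Pieri ceiling × Hilbert function of `Δ_n(per_n)` × degree-ray saturation), uniformly in the
level `m` and the degree `δ`.  Stated with unspecified constants. -/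
def PerCeilingPoly : Prop :=
  ∀ n : ℕ, ∃ C D : ℕ, ∀ (m : ℕ) [NeZero m], n ≤ m → ∀ (δ : ℕ) (lam : Nat.Partition (m * δ)),
    lam.parts.card ≤ m * m →
    orbitMultiplicity ℂ (paddedPerFormLex ℂ n m) m (partitionWeightLex m lam) ≤ C * (bodySize lam + 1) ^ D

/-- **N-C target 3 (`KroneckerTopViaBodySquares`, Manivel 2010 eq. (4) + Lemma 1, provable in principle;
census §Transfer T-B)**: the rectangular Kronecker coefficient of a shape `(Mδ − b) ∪ μ̄` at level `M` is at
most the sum of the Kronecker SQUARES `g(α, α, μ̄)` of its body over partitions `α ⊢ b` fitting an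
`M × δ` box.  Stated abstractly (body passed as a separate partition with the row-lift relation as a
hypothesis) to stay over existing declarations. -/
def KroneckerTopViaBodySquares : Prop :=
  ∀ (M δ b : ℕ) (lam : Nat.Partition (M * δ)) (body : Nat.Partition b),
    lam.parts = (M * δ - b) ::ₘ body.parts → b < M * δ - b →
    kroneckerCoeff ℂ lam (Nat.Partition.rectangle M δ) (Nat.Partition.rectangle M δ) ≤
      ∑ α ∈ (Finset.univ : Finset (Nat.Partition b)).filter
          (fun α => α.parts.card ≤ M ∧ ∀ p ∈ α.parts, p ≤ δ),
        kroneckerCoeff ℂ α α body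

/-- **S-B (`TruncRayMono`, the structural lemma the valuative top collapse would need)**: the no-cut
truncation is non-decreasing along row-lift rays (U = ⊥ version; the skew-centre version has no model at
all).  Plausible via the symmetric-Kronecker semigroup property; NOT in the tree; not registered. -/
def TruncRayMono : Prop :=
  ∀ (n δ : ℕ) [NeZero n] (μ : Nat.Partition (n * δ)), μ.parts.card ≤ n * n → ∀ (j : ℕ) [NeZero (n + j)]
    [NeZero (n + (j + 1))],
    let T : ∀ (m : ℕ) (lam : Nat.Partition (m * δ)), Submodule ℂ (MvPolynomial (MatIdx m × MatIdx m) ℂ) :=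
      fun m lam => MvPolynomial.homogeneousSubmodule (MatIdx m × MatIdx m) ℂ (m * δ) ⊓
        (⨅ (M : Matrix (MatIdx m) (MatIdx m) ℂ)
          (_ : linSubst (MatIdx m) ℂ M (detFormLex ℂ m) = detFormLex ℂ m),
          LinearMap.ker ((MvPolynomial.aeval fun p : MatIdx m × MatIdx m =>
              ∑ l : MatIdx m, M l p.2 •
                (MvPolynomial.X (p.1, l) : MvPolynomial (MatIdx m × MatIdx m) ℂ)).toLinearMap -
            (LinearMap.id : MvPolynomial (MatIdx m × MatIdx m) ℂ →ₗ[ℂ] MvPolynomial (MatIdx m × MatIdx m) ℂ))) ⊓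
        (⨅ (g : Matrix.GeneralLinearGroup (MatIdx m) ℂ) (_ : IsUpperTriangular g),
          LinearMap.ker ((MvPolynomial.aeval fun p : MatIdx m × MatIdx m =>
              ∑ l : MatIdx m, ((g⁻¹ : Matrix.GeneralLinearGroup (MatIdx m) ℂ) :
                Matrix (MatIdx m) (MatIdx m) ℂ) p.1 l •
                  (MvPolynomial.X (l, p.2) : MvPolynomial (MatIdx m × MatIdx m) ℂ)).toLinearMap -
            weightChar ((Weight.dualOfPartition (m * m) lam).toMatIdx : Weight (MatIdx m)) g •
              (LinearMap.id : MvPolynomial (MatIdx m × MatIdx m) ℂ →ₗ[ℂ] MvPolynomial (MatIdx m × MatIdx m) ℂ)))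
    Module.finrank ℂ ↥(T (n + j) (rowLift μ j)) ≤ Module.finrank ℂ ↥(T (n + (j + 1)) (rowLift μ (j + 1)))

/-- **D-D (`ExpCutChild`, the only child of a split-by-centre that the negation analysis leaves alive)**:
at every tail position some Edmonds-gap centre cuts the truncation down BELOW the padded-permanent
multiplicity although the no-cut space is not below it.  Typed only to show the shape; no engine. -/
def ExpCutChild : Prop :=
  ∀ c : ℕ, ∃ n₀ : ℕ, ∀ (n : ℕ), n₀ ≤ n → ∀ (m : ℕ) [NeZero m], n ^ 2 ≤ m → m ≤ windowTop n c →
    ∃ (U : Submodule ℂ (MatIdx m → ℂ)) (r δ : ℕ) (lam : Nat.Partition (m * δ)),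
      (∀ u ∈ U, (Matrix.of fun a b : Fin m => u (toLex (a, b))).rank ≤ r) ∧ r < m ∧ U ≠ ⊥ ∧
      lam.parts.card ≤ m * m ∧ windowTop n c < bodySize lam

/-! ## Trivial relations recorded for the census -/

/-- The crux is its own tail (landed). -/
example : TailFlip ↔ ValuativeFlip := tailFlip_iff_valuativeFlip

/-- Only positions `n² ≤ m` matter (landed, `k = 2`). -/
example := valuativeFlip_iff_polyPadded 2 (by norm_num)

end Summit.ValiantsHypothesis.ValiantsHypothesis.Cruxes.ValuativeFlip.StrategistGen1
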